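import Summits.QuantumFields.YangMills.Theorems.BalabanUVNodesN15KingModelConstantLinkFibre
import Summits.QuantumFields.YangMills.Theorems.BalabanUVNodesN15KingModelTorusPlaneWaves
import Literature.MathematicalPhysics.QuantumFieldTheory.Balaban1983to89.B5Hk163TorusHolderRate
import Literature.LinearAlgebra.Matrix.RayleighQuotient
import HarnessLib

/-!
# BalabanUVNodes ∕ N15 — THE KING-MODEL RUNG (PART Ϸ-b): CONSTANT LINK FIELDS — KING's PLANE WAVES `χ_q ⊗ ξ` ARE EXACT EIGEN-MODES OF `−cΔ_W + m²` AT CONSTANT LINKS: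
# `(−cΔ_W+m²)(χ_q ⊗ ξ) = χ_q ⊗ (H_W(q)ξ)` with the `n × n` SYMBOL `H_W(q) = (m²+2(d+1)c)·1 − cΣ_μ(e^{iq′_μ}W_μ + e^{−iq′_μ}W_μ^*)`; eigenvectors ∕ eigenvalues ∕ Rayleigh quotients
# of the symbol are eigenvectors ∕ eigenvalues ∕ Rayleigh quotients on the torus (Track A, DAG node N15 = NE2; FAN-OUT v1.1 §N15 s3 «KING-MODEL RUNG»; count-neutral)

HONEST FRAMING.  Count-neutral (cell `pub-ymgap`, seat `pub-ymgap-dag-n15-e` g48; `--supports stmt-QuantumFields-27247 --as helper` = K3ᴬ, KEY MAP v3).  Exact finite identities for King's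
fine covariance layer `−cΔ_U + m²` (PART Ͱ-a `covLapF`) at a CONSTANT link field (PART Ϸ-a `kingConstLink`) on ONE finite torus; NOT Bałaban's `G_k(U)`; NOT a node discharge; nothing
continuum ∕ ℝ⁴ ∕ OS ∕ Clay.  PART Ϸ-a gave the symbol through the vector Plancherel theorem (all `v`); THIS FILE gives it through the STENCIL (Ͱ-a `covLapF_mulVec_apply`) on plane waves,
and the spectral consequences used by PART Ϸ-d (tightness).

THE RESULTS (`K` any period vector; `W : Fin(d+1) → Matrix n n ℂ`; `ψ_μ(q) = χ_q(e_μ) = e^{iq′_μ}` ([King1986] (4.35), tree `chi`∕`sOf`)):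
* §1 `fibreOp W c m² q := (m²+2(d+1)c)·1 − c·Σ_μ(ψ_μ(q)·W_μ + conj ψ_μ(q)·W_μ^*)` (THE SYMBOL; at `W ≡ 1`, `n = 1` it is King's `Δ^η(p) + m²`, [King1986] (4.4)); `planeWaveVec q ξ (x,i) := χ_q(x)·ξ_i`;
  `rclike_ofReal_complex`∕`re_realCast_mul` (cast bridges); ★★ **`covLapF_kingConstLink_mulVec_planeWaveVec`** (`(−cΔ_W+m²)(χ_q⊗ξ) = χ_q ⊗ (H_W(q)ξ)`);
  ★ `covLapF_kingConstLink_mulVec_eq_smul` (an eigenvector `ξ` of `H_W(q)` gives the exact eigenvector `χ_q ⊗ ξ`); `planeWaveVec_ne_zero`;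
* §2 `mem_real_spectrum_of_mulVec_eq_smul`, ★★ **`exists_eigenvalue_eq_of_fibre`** — a real eigenvalue of the symbol at ANY momentum IS an eigenvalue of `−cΔ_W+m²` on the torus (spectrum = range of the eigenvalues,
  Mathlib `IsHermitian.spectrum_real_eq_range_eigenvalues`);
* §3 sizes of a plane wave: `sum_norm_fib_planeWaveVec_sq` (`Σ_x‖(χ_q⊗ξ)_x‖² = |T|·‖ξ‖²`), `star_planeWaveVec_dotProduct_mulVec` (`⟨χ_q⊗ξ, M_W(χ_q⊗ξ)⟩ = |T|·⟨ξ, H_W(q)ξ⟩`),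
  ★ **`re_form_fibreOp_eq`** (for UNITARY `W_μ`: `Re⟨ξ,H_W(q)ξ⟩ = m²‖ξ‖² + cΣ_μ‖ξ − ψ_μ(q)W_μξ‖²` — the fibre of PART Ϸ-a's symbol, from Ͱ-d's `bond_square`),
  ★★ **`exists_eigenvalue_le_fibre`** (RAYLEIGH: for every `q` and `ξ ≠ 0` some eigenvalue of `−cΔ_W+m²` is `≤ Re⟨ξ,H_W(q)ξ⟩∕‖ξ‖²`; tree `RayleighQuotient`, [HornJohnson2013] Thm 4.2.2).
PRIOR TREE ART (by name): Ϸ-a (`kingConstLink`, `kingConstLink_apply`), Ͱ-a (`covLapF`, `covLapF_mulVec_apply`, `isHermitian_covLapF`), Ͱ-b (`fib`), Ͱ-d (`bond_square`), `B5Prop11Plancherel`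
(`chi`, `chi_add_right`), `B5Hk163TorusHolderRate.chi_sub_right` (`χ_q(x − e_μ) = χ_q(x)·conj ψ_μ(q)`), `TorusSpectral.norm_chi_eq_one`, `Literature.LinearAlgebra.Matrix.RayleighQuotient.exists_eigenvalues_le_and_ge_re_form_div`,
Mathlib (`Matrix.exists_mulVec_eq_zero_iff`, `spectrum.mem_iff`, `IsHermitian.spectrum_real_eq_range_eigenvalues`).  Dedup (rg at filing): basename 0 files; needles
`fibreOp|planeWaveVec|exists_eigenvalue_eq_of_fibre|exists_eigenvalue_le_fibre|re_form_fibreOp_eq` 0 tree files (`mem_spectrum_of_mulVec_eq_smul` exists in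
`Literature.LinearAlgebra.Matrix.PerronRootStrictMonotone` for the `K`-spectrum of a `K`-matrix — here the `ℝ`-spectrum of a complex matrix, renamed `mem_real_spectrum_…`).  Locators: [King1986] (4.4) p.670, (4.35) p.674; [Balaban1984PropagatorsI]
(1.29) p.23; [Balaban1985BackgroundPropagators] (3.23) p.394; [HornJohnson2013] Thm 4.2.2.  0 `sorry`, 2 `def`.
-/

noncomputable section

open scoped BigOperators ComplexConjugate ComplexOrder InnerProductSpace
open Finset Matrix WithLp

namespace Summit.QuantumFields.YangMills.BalabanUVNodes.N15KingModelRung.ConstantCurvature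

open Literature.MathematicalPhysics.QuantumFieldTheory.Balaban1983to89.B5Prop11Plancherel (Tor unitVec chi chi_add_right)
open Literature.MathematicalPhysics.QuantumFieldTheory.Balaban1983to89.B5Hk163TorusHolderRate (chi_sub_right)
open Summit.QuantumFields.YangMills.BalabanUVNodes.N15KingModelRung.Covariant (covLapF fib fib_apply isHermitian_covLapF covLapF_mulVec_apply bond_square)
open Summit.QuantumFields.YangMills.BalabanUVNodes.N15KingModelRung.TorusSpectral (norm_chi_eq_one)
open Literature.LinearAlgebra.Matrix.RayleighQuotient (exists_eigenvalues_le_and_ge_re_form_div)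

variable {d : ℕ} (K : Fin (d + 1) → ℕ) [hK : ∀ μ, NeZero (K μ)]

/-! ## §1 The symbol and the plane waves -/

section Symbol

variable {n : Type*} [Fintype n] [DecidableEq n]

/-- THE `n × n` SYMBOL of `−cΔ_W + m²` at the constant link field `W` and momentum `q`:
`H_W(q) = (m² + 2(d+1)c)·1 − c·Σ_μ(ψ_μ(q)·W_μ + conj ψ_μ(q)·W_μ^*)`, `ψ_μ(q) = e^{iq′_μ}` (King's `Δ^η(p) + m²`, [King1986] (4.4), with the hopping dressed by the links).
[cite: King1986, (4.4) p.670, (4.35) p.674; Balaban1985BackgroundPropagators, (3.23) p.394] -/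
def fibreOp (W : Fin (d + 1) → Matrix n n ℂ) (c m2 : ℝ) (q : Tor K) : Matrix n n ℂ :=
  ((m2 + 2 * ((d : ℝ) + 1) * c : ℝ) : ℂ) • (1 : Matrix n n ℂ)
    - (c : ℂ) • ∑ μ, (chi K q (unitVec K μ) • W μ + conj (chi K q (unitVec K μ)) • (W μ)ᴴ)

/-- THE VECTOR PLANE WAVE `(χ_q ⊗ ξ)(x,i) = χ_q(x)·ξ_i` at momentum `q` with polarisation `ξ ∈ ℂⁿ`. [cite: King1986, (4.35) p.674; Balaban1984PropagatorsI, (1.29) p.23] -/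
def planeWaveVec (q : Tor K) (ξ : n → ℂ) : Tor K × n → ℂ := fun p => chi K q p.1 * ξ p.2

omit [Fintype n] [DecidableEq n] in
/-- `(χ_q ⊗ ξ)(x,i) = χ_q(x)ξ_i`. [folklore] -/
@[simp] theorem planeWaveVec_apply (q : Tor K) (ξ : n → ℂ) (x : Tor K) (i : n) : planeWaveVec K q ξ (x, i) = chi K q x * ξ i := rfl

omit hK in
/-- The generic `RCLike` real embedding into `ℂ` is the coercion `ℝ → ℂ` (syntactic bridge for lemmas stated over a general `RCLike` field). [folklore] -/
theorem rclike_ofReal_complex (r : ℝ) : (@RCLike.ofReal ℂ _ r) = (r : ℂ) := rfl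

omit hK in
/-- `Re(r·z) = r·Re z` for real `r` (the `ℂ`-coercion form). [folklore] -/
theorem re_realCast_mul (r : ℝ) (z : ℂ) : RCLike.re ((r : ℂ) * z) = r * RCLike.re z := by
  simp only [RCLike.re_to_complex, Complex.re_ofReal_mul]

omit [Fintype n] [DecidableEq n] in
/-- A plane wave with non-zero polarisation is non-zero (evaluate at `x = 0`, `χ_q(0) = 1`). [folklore] -/
theorem planeWaveVec_ne_zero (q : Tor K) {ξ : n → ℂ} (hξ : ξ ≠ 0) : planeWaveVec K q ξ ≠ 0 := by
  obtain ⟨i, hi⟩ := Function.ne_iff.mp hξ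
  intro h
  have := congr_fun h (0, i)
  rw [planeWaveVec_apply, Pi.zero_apply] at this
  have h0 : chi K q 0 = 1 := by
    have h1 := chi_add_right K q 0 0
    rw [add_zero] at h1
    have hne : chi K q 0 ≠ 0 := fun hz => by simpa [hz] using norm_chi_eq_one K q 0
    exact (mul_right_eq_self₀.mp h1.symm).resolve_right hne
  rw [h0, one_mul] at this
  exact hi this

/-- ★★ **PLANE WAVES ARE EXACT EIGEN-MODES**: `(−cΔ_W+m²)(χ_q ⊗ ξ) = χ_q ⊗ (H_W(q)ξ)` for every family of matrices `W` (the stencil Ͱ-a `covLapF_mulVec_apply`: the forward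
neighbour carries `χ_q(x+e_μ) = χ_q(x)ψ_μ(q)`, the backward one `χ_q(x−e_μ) = χ_q(x)conj ψ_μ(q)`). [cite: King1986, (4.4) p.670, (4.35) p.674; Balaban1985BackgroundPropagators, (3.23) p.394] -/
theorem covLapF_kingConstLink_mulVec_planeWaveVec (W : Fin (d + 1) → Matrix n n ℂ) (c m2 : ℝ) (q : Tor K) (ξ : n → ℂ) :
    covLapF K c m2 (kingConstLink K W) *ᵥ planeWaveVec K q ξ = planeWaveVec K q (fibreOp K W c m2 q *ᵥ ξ) := by
  funext p
  obtain ⟨x, i⟩ := p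
  rw [covLapF_mulVec_apply, planeWaveVec_apply, planeWaveVec_apply]
  have hf : ∀ μ : Fin (d + 1), (fun j => planeWaveVec K q ξ (x + unitVec K μ, j)) = (chi K q x * chi K q (unitVec K μ)) • ξ := fun μ => by
    funext j; rw [planeWaveVec_apply, chi_add_right, Pi.smul_apply, smul_eq_mul]
  have hb : ∀ μ : Fin (d + 1), (fun j => planeWaveVec K q ξ (x - unitVec K μ, j)) = (chi K q x * conj (chi K q (unitVec K μ))) • ξ := fun μ => by
    funext j; rw [planeWaveVec_apply, chi_sub_right, Pi.smul_apply, smul_eq_mul]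
  simp only [kingConstLink_apply, hf, hb, Matrix.mulVec_smul, Pi.smul_apply, smul_eq_mul]
  simp only [fibreOp, Matrix.sub_mulVec, Matrix.smul_mulVec, Matrix.one_mulVec, Matrix.sum_mulVec, Matrix.add_mulVec, Pi.sub_apply, Pi.smul_apply,
    Finset.sum_apply, Pi.add_apply, smul_eq_mul, rclike_ofReal_complex]
  rw [mul_sub, Finset.mul_sum]
  congr 1
  · ring
  · rw [Finset.mul_sum, Finset.mul_sum]
    exact Finset.sum_congr rfl fun μ _ => by ring

/-- ★ AN EIGENVECTOR OF THE SYMBOL GIVES AN EXACT EIGENVECTOR ON THE TORUS: `H_W(q)ξ = λξ ⟹ (−cΔ_W+m²)(χ_q⊗ξ) = λ·(χ_q⊗ξ)`. [cite: King1986, (4.4) p.670, (4.35) p.674] -/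
theorem covLapF_kingConstLink_mulVec_eq_smul {W : Fin (d + 1) → Matrix n n ℂ} {c m2 : ℝ} {q : Tor K} {ξ : n → ℂ} {lam : ℂ} (h : fibreOp K W c m2 q *ᵥ ξ = lam • ξ) :
    covLapF K c m2 (kingConstLink K W) *ᵥ planeWaveVec K q ξ = lam • planeWaveVec K q ξ := by
  rw [covLapF_kingConstLink_mulVec_planeWaveVec, h]
  funext p
  simp only [planeWaveVec, Pi.smul_apply, smul_eq_mul]
  ring

end Symbol

/-! ## §2 Eigenvalues of the symbol are eigenvalues on the torus -/

section Spectrum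

variable {n : Type*} [Fintype n] [DecidableEq n]

/-- A matrix with a non-trivial kernel vector for `λ·1 − M` has `λ` in its `ℝ`-spectrum. [folklore] -/
theorem mem_real_spectrum_of_mulVec_eq_smul {ι : Type*} [Fintype ι] [DecidableEq ι] {M : Matrix ι ι ℂ} {v : ι → ℂ} (hv : v ≠ 0) {lam : ℝ} (h : M *ᵥ v = (lam : ℂ) • v) :
    lam ∈ spectrum ℝ M := by
  rw [spectrum.mem_iff, Algebra.algebraMap_eq_smul_one, Matrix.isUnit_iff_isUnit_det, isUnit_iff_ne_zero, not_not]
  refine Matrix.exists_mulVec_eq_zero_iff.mp ⟨v, hv, ?_⟩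
  rw [Matrix.sub_mulVec, Matrix.smul_mulVec, Matrix.one_mulVec, h, sub_eq_zero]
  funext j
  simp only [Pi.smul_apply, Complex.real_smul, smul_eq_mul]

/-- ★★ **A REAL EIGENVALUE OF THE SYMBOL AT ANY MOMENTUM IS AN EIGENVALUE OF `−cΔ_W + m²` ON THE TORUS** (`ξ ≠ 0`, `H_W(q)ξ = λξ` ⟹ `λ ∈ {eigenvalues}`; the plane wave `χ_q ⊗ ξ` is
the eigenvector). [cite: King1986, (4.4) p.670, (4.35) p.674; HornJohnson2013, Thm 4.2.2] -/
theorem exists_eigenvalue_eq_of_fibre {W : Fin (d + 1) → Matrix n n ℂ} {c m2 : ℝ} {q : Tor K} {ξ : n → ℂ} (hξ : ξ ≠ 0) {lam : ℝ}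
    (h : fibreOp K W c m2 q *ᵥ ξ = (lam : ℂ) • ξ) :
    ∃ i, (isHermitian_covLapF K c m2 (kingConstLink K W)).eigenvalues i = lam := by
  have hmem : lam ∈ spectrum ℝ (covLapF K c m2 (kingConstLink K W)) :=
    mem_real_spectrum_of_mulVec_eq_smul (planeWaveVec_ne_zero K q hξ) (covLapF_kingConstLink_mulVec_eq_smul K h)
  rw [(isHermitian_covLapF K c m2 (kingConstLink K W)).spectrum_real_eq_range_eigenvalues] at hmem
  exact hmem

end Spectrum

/-! ## §3 Sizes of a plane wave; the fibre form; Rayleigh -/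

section Rayleigh

variable {n : Type*} [Fintype n] [DecidableEq n]

omit [DecidableEq n] in
/-- `Σ_x‖(χ_q ⊗ ξ)_x‖² = |T|·Σ_i|ξ_i|²` (`|χ_q| = 1`). [cite: King1986, (4.35) p.674] -/
theorem sum_norm_fib_planeWaveVec_sq (q : Tor K) (ξ : n → ℂ) :
    ∑ x, ‖fib K (planeWaveVec K q ξ) x‖ ^ 2 = (Fintype.card (Tor K) : ℝ) * ∑ i, ‖ξ i‖ ^ 2 := by
  have h : ∀ x : Tor K, ‖fib K (planeWaveVec K q ξ) x‖ ^ 2 = ∑ i, ‖ξ i‖ ^ 2 := fun x => by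
    rw [EuclideanSpace.norm_sq_eq]
    refine Finset.sum_congr rfl fun i _ => ?_
    show ‖planeWaveVec K q ξ (x, i)‖ ^ 2 = ‖ξ i‖ ^ 2
    rw [planeWaveVec_apply, norm_mul, norm_chi_eq_one, one_mul]
  simp only [h, Finset.sum_const, Finset.card_univ, nsmul_eq_mul]

omit [DecidableEq n] in
/-- `Σ_p |(χ_q⊗ξ)_p|² = |T|·Σ_i|ξ_i|²` (flat index form). [cite: King1986, (4.35) p.674] -/
theorem sum_norm_planeWaveVec_sq (q : Tor K) (ξ : n → ℂ) :
    ∑ p, ‖planeWaveVec K q ξ p‖ ^ 2 = (Fintype.card (Tor K) : ℝ) * ∑ i, ‖ξ i‖ ^ 2 := by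
  rw [Fintype.sum_prod_type]
  have h : ∀ x : Tor K, ∑ i, ‖planeWaveVec K q ξ (x, i)‖ ^ 2 = ∑ i, ‖ξ i‖ ^ 2 := fun x =>
    Finset.sum_congr rfl fun i _ => by rw [planeWaveVec_apply, norm_mul, norm_chi_eq_one, one_mul]
  simp only [h, Finset.sum_const, Finset.card_univ, nsmul_eq_mul]

/-- `⟨χ_q⊗ξ, (−cΔ_W+m²)(χ_q⊗ξ)⟩ = |T|·⟨ξ, H_W(q)ξ⟩`. [cite: King1986, (4.4) p.670, (4.35) p.674] -/
theorem star_planeWaveVec_dotProduct_mulVec (W : Fin (d + 1) → Matrix n n ℂ) (c m2 : ℝ) (q : Tor K) (ξ : n → ℂ) :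
    star (planeWaveVec K q ξ) ⬝ᵥ (covLapF K c m2 (kingConstLink K W) *ᵥ planeWaveVec K q ξ)
      = (Fintype.card (Tor K) : ℂ) * (star ξ ⬝ᵥ (fibreOp K W c m2 q *ᵥ ξ)) := by
  rw [covLapF_kingConstLink_mulVec_planeWaveVec]
  simp only [dotProduct, Fintype.sum_prod_type, Pi.star_apply, planeWaveVec_apply, RCLike.star_def, map_mul]
  have h : ∀ x : Tor K, ∑ i, conj (chi K q x) * conj (ξ i) * (chi K q x * (fibreOp K W c m2 q *ᵥ ξ) i) = ∑ i, conj (ξ i) * (fibreOp K W c m2 q *ᵥ ξ) i := fun x =>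
    Finset.sum_congr rfl fun i _ => by
      have h1 : conj (chi K q x) * chi K q x = 1 := by
        rw [← Complex.normSq_eq_conj_mul_self, Complex.normSq_eq_norm_sq, norm_chi_eq_one]; norm_num
      linear_combination (conj (ξ i) * (fibreOp K W c m2 q *ᵥ ξ) i) * h1
  simp only [h, Finset.sum_const, Finset.card_univ, nsmul_eq_mul]

/-- ★ **THE FIBRE FORM** (unitary `W_μ`): `Re⟨ξ, H_W(q)ξ⟩ = m²·Σ_i|ξ_i|² + c·Σ_μ‖ξ − ψ_μ(q)·W_μξ‖²` — the `q`-fibre of PART Ϸ-a's symbol is a mass plus a sum of `d+1` squares (Ͱ-d's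
`bond_square` with `a = ξ`, `b = ψ_μ(q)ξ`). [cite: King1986, (4.4) p.670; Balaban1985BackgroundPropagators, (3.23) p.394] -/
theorem re_form_fibreOp_eq {W : Fin (d + 1) → Matrix n n ℂ} (hW : ∀ μ, W μ ∈ Matrix.unitaryGroup n ℂ) (c m2 : ℝ) (q : Tor K) (ξ : n → ℂ) :
    RCLike.re (star ξ ⬝ᵥ (fibreOp K W c m2 q *ᵥ ξ))
      = m2 * ∑ i, ‖ξ i‖ ^ 2 + c * ∑ μ, ‖(toLp 2 ξ : EuclideanSpace ℂ n) - chi K q (unitVec K μ) • Matrix.toEuclideanLin (W μ) (toLp 2 ξ)‖ ^ 2 := by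
  have hnorm : ‖(toLp 2 ξ : EuclideanSpace ℂ n)‖ ^ 2 = ∑ i, ‖ξ i‖ ^ 2 := by rw [EuclideanSpace.norm_sq_eq]
  have hre : RCLike.re (star ξ ⬝ᵥ ξ) = ∑ i, ‖ξ i‖ ^ 2 := Literature.LinearAlgebra.Matrix.RayleighQuotient.re_star_dotProduct_self ξ
  -- each direction is a square (Ͱ-d `bond_square` with `a = ξ`, `b = ψ_μ(q)ξ`)
  have hsq : ∀ μ : Fin (d + 1), ‖(toLp 2 ξ : EuclideanSpace ℂ n) - chi K q (unitVec K μ) • Matrix.toEuclideanLin (W μ) (toLp 2 ξ)‖ ^ 2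
      = 2 * ∑ i, ‖ξ i‖ ^ 2 - RCLike.re (star ξ ⬝ᵥ ((chi K q (unitVec K μ) • W μ + conj (chi K q (unitVec K μ)) • (W μ)ᴴ) *ᵥ ξ)) := fun μ => by
    have hb := bond_square (hW μ) ξ (chi K q (unitVec K μ) • ξ)
    have hn2 : ‖(toLp 2 (chi K q (unitVec K μ) • ξ) : EuclideanSpace ℂ n)‖ ^ 2 = ∑ i, ‖ξ i‖ ^ 2 := by
      rw [EuclideanSpace.norm_sq_eq]
      refine Finset.sum_congr rfl fun i _ => ?_
      show ‖(chi K q (unitVec K μ) • ξ) i‖ ^ 2 = ‖ξ i‖ ^ 2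
      rw [Pi.smul_apply, smul_eq_mul, norm_mul, norm_chi_eq_one, one_mul]
    have hlin : Matrix.toEuclideanLin (W μ) (toLp 2 (chi K q (unitVec K μ) • ξ)) = chi K q (unitVec K μ) • Matrix.toEuclideanLin (W μ) (toLp 2 ξ) := by
      rw [← map_smul]; rfl
    have hpair : star ξ ⬝ᵥ (W μ *ᵥ (chi K q (unitVec K μ) • ξ)) + star (chi K q (unitVec K μ) • ξ) ⬝ᵥ ((W μ)ᴴ *ᵥ ξ)
        = star ξ ⬝ᵥ ((chi K q (unitVec K μ) • W μ + conj (chi K q (unitVec K μ)) • (W μ)ᴴ) *ᵥ ξ) := by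
      rw [Matrix.add_mulVec, dotProduct_add, Matrix.smul_mulVec, Matrix.smul_mulVec, Matrix.mulVec_smul, dotProduct_smul, star_smul, smul_dotProduct,
        dotProduct_smul, RCLike.star_def]
    rw [hnorm, hn2, hlin, hpair] at hb
    linarith
  -- the left-hand side, expanded
  have hL : RCLike.re (star ξ ⬝ᵥ (fibreOp K W c m2 q *ᵥ ξ))
      = (m2 + 2 * ((d : ℝ) + 1) * c) * ∑ i, ‖ξ i‖ ^ 2 - c * ∑ μ, RCLike.re (star ξ ⬝ᵥ ((chi K q (unitVec K μ) • W μ + conj (chi K q (unitVec K μ)) • (W μ)ᴴ) *ᵥ ξ)) := by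
    rw [fibreOp, Matrix.sub_mulVec, dotProduct_sub, map_sub, Matrix.smul_mulVec, Matrix.one_mulVec, dotProduct_smul, smul_eq_mul, re_realCast_mul, hre,
      Matrix.smul_mulVec, dotProduct_smul, smul_eq_mul, re_realCast_mul, Matrix.sum_mulVec, dotProduct_sum, map_sum]
  rw [hL]
  simp only [hsq]
  rw [Finset.sum_sub_distrib, Finset.sum_const, Finset.card_univ, Fintype.card_fin, nsmul_eq_mul]
  push_cast
  ring

/-- ★★ **RAYLEIGH ON A PLANE WAVE**: for every momentum `q` and `ξ ≠ 0`, SOME EIGENVALUE of `−cΔ_W + m²` on the torus is `≤ Re⟨ξ, H_W(q)ξ⟩ ∕ Σ_i|ξ_i|²` (the Rayleigh quotient of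
`χ_q ⊗ ξ` is that of `ξ` in the fibre). [cite: HornJohnson2013, Thm 4.2.2; King1986, (4.4) p.670, (4.35) p.674] -/
theorem exists_eigenvalue_le_fibre (W : Fin (d + 1) → Matrix n n ℂ) (c m2 : ℝ) (q : Tor K) {ξ : n → ℂ} (hξ : ξ ≠ 0) :
    ∃ i, (isHermitian_covLapF K c m2 (kingConstLink K W)).eigenvalues i ≤ RCLike.re (star ξ ⬝ᵥ (fibreOp K W c m2 q *ᵥ ξ)) / ∑ i, ‖ξ i‖ ^ 2 := by
  obtain ⟨i₀, -⟩ := Function.ne_iff.mp hξ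
  haveI : Nonempty (Tor K × n) := ⟨(0, i₀)⟩
  obtain ⟨⟨i, hi⟩, -⟩ := exists_eigenvalues_le_and_ge_re_form_div (isHermitian_covLapF K c m2 (kingConstLink K W)) (planeWaveVec_ne_zero K q hξ)
  refine ⟨i, hi.trans_eq ?_⟩
  rw [star_planeWaveVec_dotProduct_mulVec, sum_norm_planeWaveVec_sq]
  have hT : (0 : ℝ) < Fintype.card (Tor K) := by exact_mod_cast Fintype.card_pos
  have hξ2 : 0 < ∑ i, ‖ξ i‖ ^ 2 := (Literature.LinearAlgebra.Matrix.RayleighQuotient.sum_norm_sq_pos_iff ξ).mpr hξ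
  rw [show ((Fintype.card (Tor K) : ℂ)) = ((Fintype.card (Tor K) : ℝ) : ℂ) by push_cast; rfl, re_realCast_mul,
    mul_div_mul_left _ _ hT.ne']

end Rayleigh

end Summit.QuantumFields.YangMills.BalabanUVNodes.N15KingModelRung.ConstantCurvature

end
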